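import Mathlib
import Summits.PneNP.PneNP.Theorems.PstarFibreCNF
import Summits.PneNP.PneNP.Theorems.PstarPDTPolyCalc
import Literature.Computability.MetaComplexity.ResLin
import Literature.Computability.AlgebraicComplexity.CircuitGateSemantics

/-!
# From `Res(⊕)` refutations of a fibre CNF to parity decision trees (ROUND-24, item T24.3c, wiring)

FRONTIER range-avoidance ladder, rung F-N3 (cell `pnp-ideate`; restricted-model proof complexity — nothing here bears on `P` vs
`NP`).

`PstarPDT` fixed parity decision trees for the falsified-output search problem `Search(I, y)` of a local map `I : LocalMap k n m`,
`PstarFibreCNF` the CNF `fibreCNF I y` of the fibre over `ℕ`-indexed variables, and the tree's library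
`Literature.Computability.MetaComplexity.ResLin` the proof system `Res(⊕)` (lines = linear clauses; rules: initial clause,
resolution on a linear form `f`, SEMANTIC weakening; `resLinDepth` = longest premise chain of the — possibly DAG-like — derivation).
`PstarPDTResLin` (T24.3a) turned a solving tree into a PROVER of the coins game (tree-like size / coins).  This file is the converse
wiring, for DEPTH and for arbitrary (DAG-like) refutations:

* `exists_solves_of_isResLinRefutation` — a `Res(⊕)` refutation `π` of `fibreCNF I y` yields a parity decision tree solving
  `Search(I, y)` of depth `≤ resLinDepth π` (any arity `k`);
* `pc_refutable_of_isResLinRefutation` — with T24.3b (`PstarPDTPolyCalc.pc_refutable_of_solves`): for pure `P⋆` instances the fibre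
  system `fibrePolys I y` is then `PC/𝔽₂`-refutable in degree `≤ resLinDepth π + 2`;
* `le_resLinDepth_of_forall_solves` — a depth lower bound for solving parity decision trees is a depth lower bound for every
  `Res(⊕)` refutation of the fibre CNF (DAG-like included).

## The unfolding (Itsykson–Sokolov's correspondence, depth form)

Read an input `z : Fin n → Bool` as the assignment `ext z` of the `ℕ`-indexed variables (`false` beyond `n`; the CNF only mentions
variables `< n`).  Walk the refutation backwards from the empty clause keeping the invariant «the current line's linear clause is
FALSE at `ext z`»: at a resolution line `C ∪ D` on the form `f` (premises `C ∨ (f = 0)`, `D ∨ (f = 1)`) query the parity of `z` on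
`f ∩ [0, n)` (`qset f`; `linLit_eval_ext`) and move to the premise whose `f`-literal is falsified; at a semantic weakening move to
the premise (falsity transfers backwards, no query); at an initial clause — a pattern clause of some output `j` — the input reads
a falsifying pattern of `j`, so `j` is violated (`pick_spec`).  The tree `treeAt π t` so attached to line `t` (well-founded recursion
on the line index: premises point into the prefix) has depth at most the DAG depth of line `t` (`treeAt_spec`, with the prefix
calculus of `dagDepthList`: `dagDepthList_take`, `getD_dagDepthList`, `succ_getD_le_of_premise`; the list lemma
`le_foldr_max_of_mem` is reused from `CircuitGateSemantics`).
-/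

set_option linter.dupNamespace false

open Finset Literature.Computability.Complexity Literature.Computability.MetaComplexity
open Summit.PneNP.PneNP.Theorems.PstarPDT (PDT parity parity_singleton pc_refutable_of_solves)
open Summit.PneNP.PneNP.Theorems.PstarFibreCNF (fibreCNF patternClause outputClauses eval_patternClause_iff)
open Summit.PneNP.PneNP.Theorems.PstarFibrePolys (fibrePolys)
open Literature.Computability.AlgebraicComplexity.ArithCircuit (le_foldr_max_of_mem)

namespace Summit.PneNP.PneNP.Theorems.PstarPDTOfResLin

variable {k n m : ℕ}

/-! ## DAG depth: the prefix calculus of `dagDepthList` -/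

/-- One more node: its depth entry is `1 +` the maximum over its premises, looked up in the entries so far. -/
theorem dagDepthList_append_singleton (xs : List (List ℕ)) (ps : List ℕ) :
    dagDepthList (xs ++ [ps]) = dagDepthList xs ++ [(ps.map fun i => (dagDepthList xs).getD i 0 + 1).foldr max 0] := by
  simp [dagDepthList, List.foldl_append]

/-- One depth entry per node. -/
theorem length_dagDepthList (prem : List (List ℕ)) : (dagDepthList prem).length = prem.length := by
  induction prem using List.reverseRecOn with
  | nil => simp [dagDepthList]
  | append_singleton xs ps ih =>
    rw [dagDepthList_append_singleton]
    simp [ih]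

/-- PREFIX STABILITY: the depth entries of a prefix of the DAG are the prefix of the depth entries. -/
theorem dagDepthList_take (prem : List (List ℕ)) (t : ℕ) : dagDepthList (prem.take t) = (dagDepthList prem).take t := by
  induction prem using List.reverseRecOn with
  | nil => simp [dagDepthList]
  | append_singleton xs ps ih =>
    by_cases ht : t ≤ xs.length
    · rw [List.take_append_of_le_length ht, dagDepthList_append_singleton,
        List.take_append_of_le_length (by rw [length_dagDepthList]; exact ht), ih]
    · push Not at ht
      rw [List.take_of_length_le (by simp; omega), dagDepthList_append_singleton,
        List.take_of_length_le (by simp [length_dagDepthList]; omega)]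

/-- The depth entry of node `t`: `1 +` the maximum of the entries of its premises (premises looked up in the prefix). -/
theorem getD_dagDepthList (prem : List (List ℕ)) {t : ℕ} (ht : t < prem.length) :
    (dagDepthList prem).getD t 0 = ((prem[t]).map fun i => (dagDepthList (prem.take t)).getD i 0 + 1).foldr max 0 := by
  have h2 := dagDepthList_take prem (t + 1)
  rw [List.take_succ_eq_append_getElem ht, dagDepthList_append_singleton] at h2
  have h3 : ((dagDepthList prem).take (t + 1)).getD t 0 = (dagDepthList prem).getD t 0 := by
    rw [List.getD_eq_getElem?_getD, List.getD_eq_getElem?_getD, List.getElem?_take_of_lt (Nat.lt_succ_self t)]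
  have hlen : (dagDepthList (prem.take t)).length = t := by
    rw [length_dagDepthList, List.length_take]
    omega
  rw [← h3, ← h2, List.getD_eq_getElem?_getD, List.getElem?_append_right (by omega), hlen, Nat.sub_self]
  simp

/-- A premise `i < t` of node `t` has depth entry `+ 1 ≤` that of `t`. -/
theorem succ_getD_le_of_premise (prem : List (List ℕ)) {t : ℕ} (ht : t < prem.length) {i : ℕ} (hi : i ∈ prem[t])
    (hit : i < t) : (dagDepthList prem).getD i 0 + 1 ≤ (dagDepthList prem).getD t 0 := by
  rw [getD_dagDepthList prem ht]
  refine le_foldr_max_of_mem (List.mem_map.2 ⟨i, hi, ?_⟩)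
  rw [dagDepthList_take, List.getD_eq_getElem?_getD, List.getD_eq_getElem?_getD, List.getElem?_take_of_lt hit]

/-- Every depth entry is at most the DAG depth. -/
theorem getD_dagDepthList_le_dagDepth (prem : List (List ℕ)) (t : ℕ) : (dagDepthList prem).getD t 0 ≤ dagDepth prem := by
  unfold dagDepth
  rw [List.getD_eq_getElem?_getD]
  cases h : (dagDepthList prem)[t]? with
  | none => simp
  | some d => simpa using le_foldr_max_of_mem (List.mem_of_getElem? h)

/-! ## Inputs as assignments of the `ℕ`-indexed variables -/

/-- The input `z : Fin n → Bool` as an assignment of all `ℕ`-indexed variables (`false` beyond `n`). -/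
def ext (z : Fin n → Bool) : ℕ → Bool := fun i => if h : i < n then z ⟨i, h⟩ else false

/-- Below `n`, `ext z` is `z`. -/
@[simp] theorem ext_val (z : Fin n → Bool) (v : Fin n) : ext z v.val = z v := by
  simp [ext, v.isLt]

/-- The part of a linear form `f ⊆ ℕ` below `n`, as a query set. -/
def qset (f : Finset ℕ) : Finset (Fin n) := univ.filter fun v => v.val ∈ f

/-- **Convention lemma**: under `ext z` the equation `⊕_{i ∈ f} x_i = b` holds iff the parity of `z` on `f ∩ [0, n)` is `b`
(the variables `≥ n` read `false` and do not contribute). -/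
theorem linLit_eval_ext (z : Fin n → Bool) (f : Finset ℕ) (b : Bool) :
    LinLit.eval (ext z) (f, b) = true ↔ parity (qset (n := n) f) z = b := by
  have hset : (f.filter fun i => ext z i = true) = ((qset (n := n) f).filter fun v => z v = true).map Fin.valEmbedding := by
    ext i
    simp only [mem_filter, mem_map, Fin.valEmbedding_apply, qset, mem_univ, true_and]
    constructor
    · rintro ⟨hi, hz⟩
      by_cases hin : i < n
      · exact ⟨⟨i, hin⟩, ⟨hi, by simpa [ext, hin] using hz⟩, rfl⟩
      · simp [ext, hin] at hz
    · rintro ⟨v, ⟨hv, hz⟩, rfl⟩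
      exact ⟨hv, by simpa using hz⟩
  have hc : (f.filter fun i => ext z i = true).card = ((qset (n := n) f).filter fun v => z v = true).card := by
    rw [hset, card_map]
  unfold LinLit.eval PstarPDT.parity
  rw [decide_eq_true_eq, hc]
  cases b
  · simp only [Bool.toNat_false, decide_eq_false_iff_not, Nat.not_odd_iff_even, Nat.even_iff]
  · simp only [Bool.toNat_true, decide_eq_true_eq, Nat.odd_iff]

/-- A linear clause is false under `σ` iff all its equations are. -/
theorem linClause_eval_eq_false_iff (σ : ℕ → Bool) (C : LinClause) :
    LinClause.eval σ C = false ↔ ∀ l ∈ C, LinLit.eval σ l = false := by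
  simp [LinClause.eval, decide_eq_false_iff_not]

/-! ## The leaf label of an initial clause -/

section Tree

variable (I : LocalMap k n m) (y : Fin m → Bool) (j₀ : Fin m)

/-- The leaf label for a linear clause `C`: an output violated by every input at which `C` is false, if there is one (else `j₀`). -/
noncomputable def pick (C : LinClause) : Fin m :=
  if h : ∃ j : Fin m, ∀ z : Fin n → Bool, LinClause.eval (ext z) C = false → I.eval z j ≠ y j then h.choose else j₀

/-- For (the translation of) a clause of the fibre CNF the leaf label is sound: the clause is a pattern clause of some output `j`,
and an input falsifying it reads that falsifying pattern, so violates `j`. -/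
theorem pick_spec {c : Clause ℕ} (hc : c ∈ fibreCNF I y) (z : Fin n → Bool)
    (hz : LinClause.eval (ext z) (Clause.toLinClause c) = false) : I.eval z (pick I y j₀ (Clause.toLinClause c)) ≠ y (pick I y j₀ (Clause.toLinClause c)) := by
  have hex : ∃ j : Fin m, ∀ z : Fin n → Bool, LinClause.eval (ext z) (Clause.toLinClause c) = false → I.eval z j ≠ y j := by
    unfold PstarFibreCNF.fibreCNF at hc
    rw [List.mem_flatMap] at hc
    obtain ⟨j, -, hcj⟩ := hc
    unfold PstarFibreCNF.outputClauses at hcj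
    rw [List.mem_map] at hcj
    obtain ⟨u, hu, rfl⟩ := hcj
    rw [List.mem_filter, Finset.mem_toList] at hu
    have hu' : I.table j u ≠ y j := by simpa using hu.2
    refine ⟨j, fun z hz => ?_⟩
    have h1 : Clause.eval (ext z) (patternClause I j u) = false := by
      rw [← Bool.not_eq_true, Clause.eval, ← eval_toLinClause]
      simpa using hz
    have h2 : ¬ ((fun i => ext z (I.vars j i).val) ≠ u) := by
      rw [← eval_patternClause_iff, h1]
      exact Bool.false_ne_true
    push Not at h2
    have h3 : (fun i => z (I.vars j i)) = u := by
      rw [← h2]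
      funext i
      exact (ext_val z _).symm
    show I.table j (fun i => z (I.vars j i)) ≠ y j
    rwa [h3]
  unfold pick
  rw [dif_pos hex]
  exact hex.choose_spec z hz

/-! ## The tree attached to a line -/

variable (π : List ResLinLine)

/-- The parity decision tree attached to line `t` of `π` (well-founded recursion on `t`; premises out of range give junk leaves,
which valid derivations never reach): initial clause ↦ its leaf label; resolution on `f` ↦ query `f ∩ [0,n)`, answer `1` ↦ the
premise containing `f = 0`, answer `0` ↦ the premise containing `f = 1`; weakening ↦ the tree of the premise. -/
noncomputable def treeAt (t : ℕ) : PDT n m :=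
  match π[t]? with
  | none => PDT.leaf j₀
  | some l =>
    match l.rule with
    | .initial => PDT.leaf (pick I y j₀ l.clause)
    | .resolve i j f => if _h : i < t ∧ j < t then PDT.node (qset f) (treeAt j) (treeAt i) else PDT.leaf j₀
    | .weaken i => if _h : i < t then treeAt i else PDT.leaf j₀
  termination_by t
  decreasing_by all_goals omega

variable {I y π}

/-- **Correctness and depth of the unfolding.**  On a valid derivation from the fibre CNF: every input at which line `t` is false
is led by `treeAt π t` to a violated output, and `treeAt π t` has depth at most the DAG depth of line `t`. -/
theorem treeAt_spec (hπ : IsResLinDerivation (fibreCNF I y) π) : ∀ (t : ℕ) (ht : t < π.length),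
    (∀ z : Fin n → Bool, LinClause.eval (ext z) (π[t]).clause = false →
      I.eval z ((treeAt I y j₀ π t).run z) ≠ y ((treeAt I y j₀ π t).run z)) ∧
    (treeAt I y j₀ π t).depth ≤ (dagDepthList (π.map ResLinLine.premises)).getD t 0 := by
  intro t
  induction t using Nat.strong_induction_on with
  | _ t ih =>
  intro ht
  have hval := hπ t ht
  have hlen : (π.take t).length = t := by rw [List.length_take]; omega
  have hprem : (π.map ResLinLine.premises)[t]'(by simpa using ht) = (π[t]).rule.premises := by
    simp [ResLinLine.premises]
  have htm : t < (π.map ResLinLine.premises).length := by simpa using ht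
  unfold IsValidResLinLine at hval
  rw [treeAt, List.getElem?_eq_getElem ht]
  simp only
  rcases hr : (π[t]).rule with _ | ⟨i, j, f⟩ | i
  · -- initial clause
    simp only [hr] at hval ⊢
    obtain ⟨c, hc, hcl⟩ := hval
    refine ⟨fun z hz => ?_, by simp [PDT.depth]⟩
    simp only [PDT.run]
    rw [hcl] at hz ⊢
    exact pick_spec I y j₀ hc z hz
  · -- resolution on `f`
    simp only [hr] at hval ⊢
    obtain ⟨hi, hj, C, D, hCi, hDj, hCD⟩ := hval
    rw [hlen] at hi hj
    rw [List.getElem_take] at hCi hDj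
    rw [dif_pos ⟨hi, hj⟩]
    obtain ⟨ihi1, ihi2⟩ := ih i hi (by omega)
    obtain ⟨ihj1, ihj2⟩ := ih j hj (by omega)
    refine ⟨fun z hz => ?_, ?_⟩
    · rw [hCD, linClause_eval_eq_false_iff] at hz
      simp only [PDT.run]
      by_cases hpar : parity (qset (n := n) f) z = true
      · rw [if_pos hpar]
        refine ihi1 z ?_
        rw [hCi, linClause_eval_eq_false_iff]
        intro l hl
        rcases Finset.mem_insert.1 hl with rfl | hl
        · rw [Bool.eq_false_iff]
          intro h
          rw [linLit_eval_ext] at h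
          rw [h] at hpar
          exact Bool.false_ne_true hpar
        · exact hz l (Finset.mem_union_left _ hl)
      · rw [if_neg hpar]
        refine ihj1 z ?_
        rw [hDj, linClause_eval_eq_false_iff]
        intro l hl
        rcases Finset.mem_insert.1 hl with rfl | hl
        · rw [Bool.eq_false_iff]
          intro h
          rw [linLit_eval_ext] at h
          exact hpar h
        · exact hz l (Finset.mem_union_right _ hl)
    · simp only [PDT.depth]
      have h1 := succ_getD_le_of_premise (π.map ResLinLine.premises) htm (i := i)
        (by rw [hprem, hr]; simp [ResLinRule.premises]) hi
      have h2 := succ_getD_le_of_premise (π.map ResLinLine.premises) htm (i := j)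
        (by rw [hprem, hr]; simp [ResLinRule.premises]) hj
      omega
  · -- semantic weakening
    simp only [hr] at hval ⊢
    obtain ⟨hi, himp⟩ := hval
    rw [hlen] at hi
    rw [dif_pos hi]
    obtain ⟨ihi1, ihi2⟩ := ih i hi (by omega)
    refine ⟨fun z hz => ihi1 z ?_, ?_⟩
    · rw [Bool.eq_false_iff]
      intro h
      have h' := himp (ext z) (by rw [List.getElem_take]; exact h)
      rw [hz] at h'
      exact Bool.false_ne_true h'
    · have h1 := succ_getD_le_of_premise (π.map ResLinLine.premises) htm (i := i)
        (by rw [hprem, hr]; simp [ResLinRule.premises]) hi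
      omega

end Tree

/-! ## The wiring theorems -/

/-- No `Res(⊕)` derivation from the empty CNF has any line (so `m = 0`, where the fibre CNF is empty, never occurs below). -/
theorem eq_nil_of_isResLinDerivation_nil {π : List ResLinLine} (hπ : IsResLinDerivation ([] : CNF ℕ) π) : π = [] := by
  rcases π with _ | ⟨l, π⟩
  · rfl
  · exfalso
    have h0 := hπ 0 (by simp)
    unfold IsValidResLinLine at h0
    rcases hr : l.rule with _ | ⟨i, j, f⟩ | i
    · simp [hr] at h0
    · simp only [List.getElem_cons_zero, hr, List.take_zero, List.length_nil] at h0
      obtain ⟨hi, -⟩ := h0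
      exact absurd hi (Nat.not_lt_zero _)
    · simp only [List.getElem_cons_zero, hr, List.take_zero, List.length_nil] at h0
      obtain ⟨hi, -⟩ := h0
      exact absurd hi (Nat.not_lt_zero _)

/-- **T24.3c — `Res(⊕)` refutations unfold to parity decision trees.**  A `Res(⊕)` refutation `π` (DAG-like allowed) of the fibre
CNF of `I : LocalMap k n m` at `y` yields a parity decision tree solving `Search(I, y)` of depth `≤ resLinDepth π`. -/
theorem exists_solves_of_isResLinRefutation {I : LocalMap k n m} {y : Fin m → Bool} {π : List ResLinLine}
    (h : IsResLinRefutation (fibreCNF I y) π) : ∃ T : PDT n m, T.Solves I y ∧ T.depth ≤ resLinDepth π := by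
  obtain ⟨hder, l, hl, hempty⟩ := h
  obtain ⟨t, ht, rfl⟩ := List.getElem_of_mem hl
  rcases Nat.eq_zero_or_pos m with hm | hm
  · exfalso
    subst hm
    have hnil : fibreCNF I y = [] := by
      unfold PstarFibreCNF.fibreCNF
      simp
    rw [hnil] at hder
    have := eq_nil_of_isResLinDerivation_nil hder
    subst this
    exact absurd ht (Nat.not_lt_zero _)
  refine ⟨treeAt I y ⟨0, hm⟩ π t, fun z => (treeAt_spec (j₀ := ⟨0, hm⟩) hder t ht).1 z ?_, ?_⟩
  · rw [hempty]
    rfl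
  · exact (treeAt_spec (j₀ := ⟨0, hm⟩) hder t ht).2.trans (getD_dagDepthList_le_dagDepth _ _)

/-- Hence a depth lower bound for solving parity decision trees is a depth lower bound for every `Res(⊕)` refutation of the
fibre CNF, DAG-like refutations included. -/
theorem le_resLinDepth_of_forall_solves {I : LocalMap k n m} {y : Fin m → Bool} {d : ℕ}
    (hd : ∀ T : PDT n m, T.Solves I y → d ≤ T.depth) {π : List ResLinLine} (h : IsResLinRefutation (fibreCNF I y) π) :
    d ≤ resLinDepth π := by
  obtain ⟨T, hT, hdep⟩ := exists_solves_of_isResLinRefutation h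
  exact (hd T hT).trans hdep

/-- With T24.3b: for pure `P⋆` instances, a `Res(⊕)` refutation of the fibre CNF of depth `d` gives a `PC/𝔽₂` refutation of
the fibre polynomial system in degree `≤ d + 2`. -/
theorem pc_refutable_of_isResLinRefutation {I : LocalMap 4 n m} {y : Fin m → Bool} (hI : I.IsPure xorAndPred)
    {π : List ResLinLine} (h : IsResLinRefutation (fibreCNF I y) π) :
    PC.RefutableInDegree (fibrePolys I y) (resLinDepth π + 2) := by
  obtain ⟨T, hT, hdep⟩ := exists_solves_of_isResLinRefutation h
  exact (pc_refutable_of_solves hI hT).mono (by omega)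

end Summit.PneNP.PneNP.Theorems.PstarPDTOfResLin
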